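import Summits.HodgeConjecture.HodgeConjecture.Cruxes.BlochSeedDiscOne.MonadAlphabet
import Summits.HodgeConjecture.HodgeConjecture.Cruxes.BlochSeedDiscOne.StrengthenEinfRow

/-!
# Seed checker v30 — two JSON-side screens for NON-BOX presentations: the CHERN–HALL screen (class-level local-freeness) and the
# EXT² THREE-DIAGONAL FLOOR with twist classes (hsemireg-c5c8-1 g30, MINT A5 «C5–C8 seed-checker typing spec»)

Crux of record `Summit.HodgeConjecture.HodgeConjecture.Theses.EightfoldBlochSeeds.BlochSeedDiscOne` (item stmt-HodgeConjecture-18881; line token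
`Cruxes/BlochSeedDiscOne/Lines/birth.lean` 814a6a70c14e831a `stub_rung_pad4_seedAt`).  HONEST FRAMING: this file is a TYPING SPEC — definitions with
bodies (functionals of a `MonadAlphabet.Presentation` and of a class function on the compound frame `XWord`) plus arithmetic lemmas.  Nothing here is
proved toward HC ∕ HC_CM ∕ HC_AV ∕ №4 ∕ 26512 ∕ 18881 ∕ H2; the stub is neither restated nor weakened.  The two screens were run (exact integer
arithmetic, `seedcheck_json.py` 02bba3ec…) on semihom-2 g14's two U2-TORUS-TOY presentation JSONs (d66927515841dbdf, 5768bd6a0f7ae530); the numbers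
quoted below are from `seedcheck-toyPres.json` d601dddb… ∕ `seedcheck-toyPresB.json` ce09981f… (memo SEED-CHECKER-C5C8-c5c8-1-g30.md).

§1 CHERN–HALL SCREEN (new; C0-level, decidable on the JSON).  UP reading `⊕_P → ⊕_N → 𝓔 → 0` over `nonboxAlphabet` (cells = `rk` copies of a line
bundle `L_M`, `Live x y` iff `M_y − M_x` nef iff `Hom(L_{M_x}, L_{M_y} ⊗ P) ≠ 0` for SOME `P ∈ Pic⁰`).  For `S ⊆ P` let `Γ(S) ⊆ N` be the live
neighbourhood and `ρ(S) = rank(Γ(S)) − rank(S)`.  In EVERY realisation (any Pic⁰-twists of the copies, any display `φ`) the image of `⊕_S` lies in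
`⊕_{Γ(S)}` (not live ⇒ `Hom = 0` for every twist), so `𝓔` locally free ⇒ `φ_x` injective on `S_x` for all `x` ⇒ `coker(S → Γ(S))` locally free of
rank `ρ(S)` ⇒ (Whitney) `c_k(ch Γ(S) − ch S) = 0` for `ρ(S) < k ≤ 8`.  Typed here: `liveNbhd`, `residueCh`, `rhoX`, the first two Chern components
`cOneX`, `cTwoX` of a class function (`c₂ = (c₁² − 2ch₂)/2` in the bigraded word algebra, rows and columns antisymmetrised separately so that
`x^p/p! ↔ p×p minors` matches `compoundCh`), and the `k = 2` instance `ChernHallTwo` (the one that fires on toyPres: `ρ(P) = 33 − 32 = 1`,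
`c₂(33[L_{4I}] − Σ_P [L_s])` has 36 non-zero size-2 words, e.g. `({0,1};{0,1}) ↦ 1024` — so toyPres is NEVER the class of a vector-bundle cokernel;
toyPresB: `ρ = 32`, lettered `ρ = 8`: vacuous = semihom-2's «stable range»).  Single-letter thresholds (same run): a lettered `P`-cell live under
`γ` copies of the apex needs `γ ≥ 5` (`c_k((1+A)^γ (1+ℓ)^{-1}) ≠ 0` for some `k > γ − 1` iff `γ ≤ 4`) = the five-section rule on the p.p. 4-fold
quotient `X ∕ K_s`.

§2 EXT² THREE-DIAGONAL FLOOR with TWIST CLASSES (C7-necessary; the abstract skeleton is ALREADY in the tree and is CITED, not restated: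
`EinfRow.middle_homology_floor`, `EinfRow.source_set_floor`, `B4DoorCount.e2_count`, `B4DoorCount.b0`).  New here: the functionals on a general
`Presentation 𝔠` with a cohomology ORACLE `hq s t q = h^q(Hom(s, t))` per copy pair and a DIAGONAL WEIGHT `sq Z ∈ [m_Z, m_Z²]` = `Σ_j c_j²` for a
splitting of the `m_Z` copies of `Z` into cohomologically orthogonal twist classes of sizes `c_j` (literal reading: `sq = m²`):
`ext²(𝓔_φ, 𝓔_φ) ≥ [e₁(−1,3) − e₁(0,3) − e₁(1,2)]₊ + [e₁(0,2) − e₁(1,2) − e₁(−1,2)]₊ + [e₁(1,1) − e₁(0,1) − e₁(−1,2)]₊` for every `φ`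
(three graded pieces of the abutment filtration; column 0 is final).  Budgets of record (SeedCheckerKit v6.2 `lciDoorBudget_eq` = 3136,
`sheafDoorBudget_window` = 5572; all `q`: `C(16,6) = 8008`): floor > budget ⇒ the semiregularity map is not injective on `Ext²` for ANY `φ`.
Oracle used in the run (Mumford §16 + index theorem on `E_i⁸`): `H` non-degenerate of index `n` ⇒ `h^q = |det H|·[q = n]`; degenerate of corank `k`,
reduced determinant `D` ⇒ `h^q = C(k, q − n)·D` for a kernel-trivial twist, else `0`.  Verdicts: toyPres literal 32 284 (dead for every `φ`; block of
the 33 identical apex copies alone 24 156); toyPresB literal 48 384 ∕ 40 704 ∕ 39 136 (dead for every `φ`); the fully-live twist classes of the apex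
form a coset of `F = (Λ ∕ Σ_{s∈P} Λ ∩ ker(M_apex − M_s))^ ≅ (ℤ∕2)⁴` (16 classes, elementary divisors `2,2,2,2`); toyPresB survives the floor only
with the 40 apex copies spread over `r ≥ 5` classes (window 5572; `r = 5` with the 8 bottom copies split: 5 280) — and `r ≥ 5` is also forced by the
five-section rule.  §3 records the class-size arithmetic (`classFloor c p = 28c² − cp`, fatal from `c ≥ 21 ∕ 18 ∕ 15` at `p ≤ 192`).

Elaborates against MonadAlphabet + StrengthenEinfRow only (everything newer in this directory is unbuilt on the farm at the time of writing).
No `sorry`, no new axioms, no `instance`, no `notation`.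
-/

set_option linter.dupNamespace false
set_option linter.unusedVariables false

namespace Summit.HodgeConjecture.HodgeConjecture.Cruxes.BlochSeedDiscOne.SeedChecker.BlockFloor

open Finset BigOperators
open Summit.HodgeConjecture.HodgeConjecture.Cruxes.BlochSeedDiscOne.MonadAlphabet

variable {R : Type} [CommRing R]

/-! ## §1 The Chern–Hall screen (class-level local-freeness obstruction) -/

section ChernHall

variable {W : Type} {𝔠 : CellAlphabet R W} (Pr : Presentation 𝔠)

/-- the LIVE NEIGHBOURHOOD `Γ(S) ⊆ N` of a set `S` of `P`-cells (UP reading: `P`-cell `s` live below `N`-cell `n`). -/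
noncomputable def liveNbhd (S : Finset 𝔠.Cell) : Finset 𝔠.Cell := by
  classical exact Pr.N.filter (fun n => ∃ s ∈ S, 𝔠.Live s n)

theorem liveNbhd_subset (S : Finset 𝔠.Cell) : liveNbhd Pr S ⊆ Pr.N := by
  classical
  unfold liveNbhd; exact Finset.filter_subset _ _

/-- the RESIDUE CLASS `ch Γ(S) − ch S` (the class of `coker(⊕_S → ⊕_{Γ(S)})`, which must be a rank-`ρ(S)` vector bundle in every realisation). -/
noncomputable def residueCh (S : Finset 𝔠.Cell) : W → R :=
  ∑ n ∈ liveNbhd Pr S, Pr.mN n • 𝔠.ch n - ∑ s ∈ S, Pr.mP s • 𝔠.ch s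

/-- at `S = P` with nothing bare (`Γ(P) = N`) the residue class is the class of the presentation. -/
theorem residueCh_eq_wch_of_liveNbhd_eq (h : liveNbhd Pr Pr.P = Pr.N) : residueCh Pr Pr.P = Pr.wch := by
  unfold residueCh Presentation.wch; rw [h]

end ChernHall

section ChernX

/-- `c₁` of a class function on the compound frame: its size-1 part. -/
def cOneX (T : XWord → R) : XWord → R := fun IJ => if IJ.1.card = 1 ∧ IJ.2.card = 1 then T IJ else 0

/-- `c₂ = (c₁² − 2 ch₂) ∕ 2` of a class function on the compound frame, on size-2 words `I = {i < k}`, `J = {j < l}`: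
`T({i};{j})·T({k};{l}) − T({i};{l})·T({k};{j}) − T(I;J)` (rows∕columns antisymmetrised separately, so that for `T = compoundCh 1 M` the first two
terms are `det M[I;J]` and `c₂(L_M) = 0`, `cTwoX_lineBundle_probe`). Zero off size 2. -/
def cTwoX (T : XWord → R) : XWord → R := fun IJ =>
  match enum8 IJ.1, enum8 IJ.2 with
  | [i, k], [j, l] => T ({i}, {j}) * T ({k}, {l}) - T ({i}, {l}) * T ({k}, {j}) - T IJ
  | _, _ => 0

/-- probe: `c₂` of ONE line bundle vanishes — on the block-diagonal integer Hermitian matrix `[[2,−1],[−1,2]]^{⊕4}`, at two words. [`decide`] -/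
theorem cTwoX_lineBundle_probe :
    let M : Matrix (Fin 8) (Fin 8) GaussianInt := Matrix.of fun i j =>
      (((if i = j then (2 : ℤ) else 0) + (if (i.val + j.val) % 2 = 1 ∧ (i.val / 2 = j.val / 2) then -1 else 0) : ℤ) : GaussianInt)
    cTwoX (compoundCh 1 M) ({0, 1}, {0, 1}) = 0 ∧ cTwoX (compoundCh 1 M) ({0, 2}, {1, 3}) = 0 := by
  decide

/-- probe: for `rk = 2` copies of the same line bundle `c₂ = x²` does NOT vanish (`c = (1 + x)²`): the screen sees rank weights. [`decide`] -/
theorem cTwoX_twoCopies_probe :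
    let M : Matrix (Fin 8) (Fin 8) GaussianInt := Matrix.of fun i j => if i = j then (1 : GaussianInt) else 0
    cTwoX (compoundCh 2 M) ({0, 1}, {0, 1}) = 2 := by
  decide

variable {𝔠 : CellAlphabet R XWord} (Pr : Presentation 𝔠)

/-- `ρ(S)` on the compound frame: the unit-word coefficient (rank) of the residue class. -/
noncomputable def rhoX (S : Finset 𝔠.Cell) : R := residueCh Pr S oneXWord

/-- **CHERN–HALL, the `k = 2` instance** (the one that fires at residual rank `ρ(S) = 1`): every `S ⊆ P` whose residue has rank `1` has a residue
class with vanishing `c₂` (a rank-one locally free sheaf is a line bundle).  toyPres FAILS it at `S = P` (`ρ = 1`, 36 non-zero `c₂`-words). -/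
def ChernHallTwo : Prop :=
  ∀ S ∈ Pr.P.powerset, rhoX Pr S = 1 → ∀ IJ : XWord, cTwoX (residueCh Pr S) IJ = 0

/-- **CHERN–HALL, general schema**: parametrised by a Chern functional `chernX k T` (the `k`-th Chern class of the class function `T` in the word
algebra, `k ≤ 8`; `k = 1, 2` are `cOneX`, `cTwoX`; higher `k` by Newton's identities — computed outside Lean in the g30 run) and an integer rank
reading `rho` of `S`: all Chern classes above the residual rank vanish. -/
def ChernHallScreen (chernX : ℕ → (XWord → R) → XWord → R) (rho : Finset 𝔠.Cell → ℤ) : Prop :=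
  ∀ S ∈ Pr.P.powerset, ∀ k : ℕ, rho S < k → k ≤ 8 → ∀ IJ : XWord, chernX k (residueCh Pr S) IJ = 0

theorem chernHallScreen_two_of (chernX : ℕ → (XWord → R) → XWord → R) (rho : Finset 𝔠.Cell → ℤ)
    (h2 : chernX 2 = cTwoX) (hrho : ∀ S ∈ Pr.P.powerset, rhoX Pr S = 1 → rho S = 1)
    (h : ChernHallScreen Pr chernX rho) : ChernHallTwo Pr := by
  intro S hS h1 IJ
  have := h S hS 2 (by rw [hrho S hS h1]; norm_num) (by norm_num) IJ
  rwa [h2] at this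

end ChernX

/-! ## §2 The Ext² three-diagonal floor as functionals of a presentation (oracle `hq`, diagonal weight `sq`) -/

section Floor

variable {W : Type} {𝔠 : CellAlphabet R W} (Pr : Presentation 𝔠)
variable (hq : 𝔠.Cell → 𝔠.Cell → ℕ → ℤ) (sq : 𝔠.Cell → ℤ)

/-- `e₁(0,q) = h^q(End P) + h^q(End N)` with the same-cell pairs weighted by `sq Z` (= `Σ_j c_j²` over the twist classes of the copies of `Z`;
literal reading `sq Z = m_Z²`) and distinct-cell pairs by `m_Z m_Z'`. -/
noncomputable def eZero (q : ℕ) : ℤ := by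
  classical exact
  (∑ s ∈ Pr.P, (sq s * hq s s q + ∑ t ∈ Pr.P.erase s, Pr.mP s * Pr.mP t * hq s t q)) +
    ∑ s ∈ Pr.N, (sq s * hq s s q + ∑ t ∈ Pr.N.erase s, Pr.mN s * Pr.mN t * hq s t q)

/-- `e₁(1,q) = h^q(Hom(P, N))`. -/
def ePlus (q : ℕ) : ℤ := ∑ s ∈ Pr.P, ∑ t ∈ Pr.N, Pr.mP s * Pr.mN t * hq s t q

/-- `e₁(−1,q) = h^q(Hom(N, P))`. -/
def eMinus (q : ℕ) : ℤ := ∑ s ∈ Pr.N, ∑ t ∈ Pr.P, Pr.mN s * Pr.mP t * hq s t q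

/-- floor of the graded piece `E_∞^{0,2} = E₂^{0,2}`: `e₁(0,2) − e₁(1,2) − e₁(−1,2)` (`EinfRow.middle_homology_floor`). -/
noncomputable def fZeroTwo : ℤ := eZero Pr hq sq 2 - ePlus Pr hq 2 - eMinus Pr hq 2

/-- floor of `E_∞^{1,1} = E₃^{1,1}`: `e₁(1,1) − e₁(0,1)` (incoming `d₁`) `− e₁(−1,2)` (incoming `d₂`). -/
noncomputable def fOneOne : ℤ := ePlus Pr hq 1 - eZero Pr hq sq 1 - eMinus Pr hq 2

/-- floor of `E_∞^{−1,3}`: `e₁(−1,3) − e₁(0,3)` (outgoing `d₁`) `− e₁(1,2)` (outgoing `d₂`). -/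
noncomputable def fMinusOneThree : ℤ := eMinus Pr hq 3 - eZero Pr hq sq 3 - ePlus Pr hq 2

/-- **the three-diagonal floor** `[f₋₁,₃]₊ + [f₀,₂]₊ + [f₁,₁]₊ ≤ dim Ext²(𝓔_φ, 𝓔_φ)` (sum of the three graded pieces of total degree 2). -/
noncomputable def floorThree : ℤ := max 0 (fMinusOneThree Pr hq sq) + max 0 (fZeroTwo Pr hq sq) + max 0 (fOneOne Pr hq sq)

/-- the screen: the presentation is DEAD for the budget `B` (every display `φ`, in the twist pattern encoded by `hq ∕ sq`) when the floor exceeds `B`. -/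
def FloorKills (B : ℤ) : Prop := B < floorThree Pr hq sq

theorem floorThree_nonneg : 0 ≤ floorThree Pr hq sq := by
  unfold floorThree
  have h1 := le_max_left 0 (fMinusOneThree Pr hq sq)
  have h2 := le_max_left 0 (fZeroTwo Pr hq sq)
  have h3 := le_max_left 0 (fOneOne Pr hq sq)
  omega

theorem floorKills_mono {B B' : ℤ} (hBB' : B' ≤ B) (h : FloorKills Pr hq sq B) : FloorKills Pr hq sq B' :=
  lt_of_le_of_lt hBB' h

/-- the `E₂^{0,2}` piece alone already kills when it exceeds the budget. -/
theorem floorKills_of_fZeroTwo {B : ℤ} (h : B < fZeroTwo Pr hq sq) : FloorKills Pr hq sq B := by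
  unfold FloorKills floorThree
  have h1 := le_max_left 0 (fMinusOneThree Pr hq sq)
  have h2 := le_max_right 0 (fZeroTwo Pr hq sq)
  have h3 := le_max_left 0 (fOneOne Pr hq sq)
  omega

/-- the BLOCK FLOOR of ONE twist class of `c` identical copies of an `N`-cell `t` (retraction onto the block, `EinfRow.source_set_floor` with
`VI = H²(End block)`): `h²(𝒪)·rk²·c² − c·Σ_{s∈P} m_s [h²(Hom(s,t)) + h²(Hom(t,s))]`. -/
def blockFloor (h2O : ℤ) (t : 𝔠.Cell) (c : ℤ) : ℤ :=
  h2O * c ^ 2 - c * ∑ s ∈ Pr.P, Pr.mP s * (hq s t 2 + hq t s 2)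

end Floor

/-! ## §3 Class-size arithmetic (`h²(𝒪_{E⁸}) = 28`; per-copy subtraction `p = 192 = 32·6` on both toys) -/

section Arithmetic

/-- the one-class block floor as a function of class size `c` and per-copy subtraction `p`: `28c² − cp` (= `B4DoorCount.b0 (c²) (cp)`). -/
def classFloor (c p : ℤ) : ℤ := 28 * c ^ 2 - c * p

/-- a twist class of `≥ 21` identical copies is fatal for the all-`q` budget `8008` whenever the per-copy subtraction is `≤ 192`. -/
theorem classFloor_kills_allq {c p : ℤ} (hc : 21 ≤ c) (hp0 : 0 ≤ p) (hp : p ≤ 192) : 8008 < classFloor c p := by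
  unfold classFloor; nlinarith [mul_nonneg (sub_nonneg.mpr hc) (sub_nonneg.mpr hp), mul_nonneg (sub_nonneg.mpr hc) (sub_nonneg.mpr hc)]

/-- … `≥ 18` copies for the window budget `5572` … -/
theorem classFloor_kills_window {c p : ℤ} (hc : 18 ≤ c) (hp0 : 0 ≤ p) (hp : p ≤ 192) : 5572 < classFloor c p := by
  unfold classFloor; nlinarith [mul_nonneg (sub_nonneg.mpr hc) (sub_nonneg.mpr hp), mul_nonneg (sub_nonneg.mpr hc) (sub_nonneg.mpr hc)]

/-- … `≥ 15` copies for the LCI budget `3136`. -/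
theorem classFloor_kills_lci {c p : ℤ} (hc : 15 ≤ c) (hp0 : 0 ≤ p) (hp : p ≤ 192) : 3136 < classFloor c p := by
  unfold classFloor; nlinarith [mul_nonneg (sub_nonneg.mpr hc) (sub_nonneg.mpr hp), mul_nonneg (sub_nonneg.mpr hc) (sub_nonneg.mpr hc)]

/-- tightness of the three thresholds at `p = 192`, and the two literal apex blocks (toyPres `c = 33`, toyPresB `c = 40`). [`decide`] -/
theorem classFloor_table :
    classFloor 20 192 = 7360 ∧ classFloor 17 192 = 4828 ∧ classFloor 14 192 = 2800 ∧
      classFloor 33 192 = 24156 ∧ classFloor 40 192 = 37120 := by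
  unfold classFloor; norm_num

/-- Cauchy–Schwarz for class sizes: `r` classes of total `m` copies have `Σ c_j² ≥ m² ∕ r`, i.e. `(Σ c)² ≤ r · Σ c²`. -/
theorem sq_sum_le_card_mul_sum_sq {ι : Type} (s : Finset ι) (c : ι → ℤ) :
    (∑ j ∈ s, c j) ^ 2 ≤ s.card * ∑ j ∈ s, c j ^ 2 := by
  have h := Finset.sum_mul_sq_le_sq_mul_sq s c (fun _ => (1 : ℤ))
  simp only [one_pow, sum_const, nsmul_eq_mul, mul_one] at h
  exact h.trans (le_of_eq (mul_comm _ _))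

/-- toyPres' apex (`m = 33`, `p = 192`, letter part of `e₁(0,2) − e₁(1,2) − e₁(−1,2)` equal to `1792 − 6336 = −4544`): with `r ≤ 2` classes
`Σ c² ≥ 545` and the `E₂^{0,2}` floor `28·Σc² − 4544 ≥ 10716 > 8008`; three balanced classes give `28·363 − 4544 = 5620 ≤ 5572 + 48` (window
dead only through the `E^{1,1}` piece, total 6428) — the digits of the g30 r-table. [`norm_num`] -/
theorem toyPres_split_digits :
    (33 : ℤ) ^ 2 = 1089 ∧ (17 : ℤ) ^ 2 + 16 ^ 2 = 545 ∧ 2 * 545 ≥ (33 : ℤ) ^ 2 ∧ 28 * 545 - 4544 = (10716 : ℤ) ∧ (8008 : ℤ) < 10716 ∧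
      3 * (11 : ℤ) ^ 2 = 363 ∧ 28 * 363 - 4544 = (5620 : ℤ) := by
  norm_num

end Arithmetic

end Summit.HodgeConjecture.HodgeConjecture.Cruxes.BlochSeedDiscOne.SeedChecker.BlockFloor
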